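import Literature.AnabelianGeometry.EtaleTheta.Discharge.Sec1Prop15QuotOfYCoordKit
import Literature.AnabelianGeometry.EtaleTheta.SettingModelChiProp15iiQuot
import Literature.AnabelianGeometry.EtaleTheta.SettingModelChiProp15iiiSplitNegative
import Literature.AnabelianGeometry.EtaleTheta.SettingModelChiYCoordKit
import HarnessLib

/-!
# [EtTh] Prop. 1.5 (i) «F¹/F² = Ẑ·log(U)»: the root predicate `Prop15iQuot` WITNESSED at the χ-model — and the
# stage-1 TRUTH TABLE of Prop. 1.5: (i) ✓ (ii) ✓ (iii) ✗ (i)-Quot ✓ (ii)-Quot ✓ at ONE Kummer datum of `modelχ`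

S. Mochizuki, *The étale theta function and its Frobenioid-theoretic manifestations*, Publ. RIMS **45** (2009) [EtTh],
§1, Prop. 1.5 (i)(ii)(iii), PRIMS PDF p. 23 (printed 249): «F¹/F² = Hom((Δ^tp_Y)^ell/Δ_Θ, Δ_Θ) = Ẑ·log(U) … where … the
symbol log(U) [denotes] the standard isomorphism (Δ^tp_Y)^ell/Δ_Θ ⥲ Ẑ(1) ⥲ Δ_Θ» [cite: MochizukiEtTh2009, Prop 1.5 (i) p.23].

Layer L2 of the abc-iut cell, seat abc-iut-L2-t6 (gen 7), row «PROP15-QUOT FROM A Y-COORDINATE KIT (generic) + INSTANCES»,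
stage-1 part. PROOF-ONLY (0 definitions). abc-iut-L2-d1's `SettingModelChiProp15iiQuot` witnessed the `Ÿ`-side
identification `Prop15iiQuot` at abc-iut-L2-t1's χ-model `ThetaSetting.modelχ p`; this file adds the `Y`-SIDE
identification `Prop15iQuot` («F¹/F² = Ẑ·log(U)») there, through the generic kit route
(`Discharge/Sec1Prop15QuotOfYCoordKit`) applied to abc-iut-w5-d171's kit `yCoordKitχ p` (whose `log(U)` IS the F6 class
`logUχ p`, `rfl`), the one genuinely new kit law being

* `yThetaχ_eq_one_iff_mem_deltaTheta_of_mem_dtpY` — on `(Δ^tp_Y)^Θ` (not only on `(Δ^tp_Ÿ)^Θ`), `ŷ = 1 ↔ ∈ Δ_Θ`.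

RESULTS: `prop15iQuot_modelχ_of_logU_eq` (every Kummer datum of `modelχ` whose `log(U)` is `logUχ`), instances
**`prop15iQuot_kummerDataχSec`**, `prop15iQuot_kummerDataχ`, `prop15iQuot_ofSection_modelχ` (every section datum of
`kummerCoreχ`), the kit-route re-derivation `prop15iiQuot_modelχ_of_logUdd_eq` / `prop15iiQuot_ofSection_modelχ` of
abc-iut-L2-d1's `Ÿ`-side result for EVERY section datum, and the **stage-1 truth table**
**`prop15_truthTable_kummerDataχSec`**: at the section Kummer datum `kummerDataχSec p` of the SPLIT χ-model, Prop. 1.5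
(i) ∧ (ii) ∧ (i)-Quot ∧ (ii)-Quot HOLD (abc-iut-L6-d5 p437633, abc-iut-L2-d1 p445509, this file) while (iii) FAILS for
every `η̈` (abc-iut-L2-t12's `not_prop15iii_etaleThetaDataχSec`) — to be read next to the stage-2 table
`SettingModelTateProp15Quot.prop15_all_five_inrSection_modelχq` (all five ✓ at the Tate-sheared `modelχq p 1 2`).
Root census: `ThetaSetting.exists_isEtThOrigin_prop15iQuot`, `ThetaSetting.exists_isEtThOrigin_prop15_four_not_iii`.
HONEST FRAMING: SEMI-SYNTHETIC model — consistency / non-vacuity evidence for the typed interface ONLY; nothing of [EtTh]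
is asserted; typed ≠ proved; no side is taken on [IUTchIII] Cor. 3.12.
-/

noncomputable section

namespace Literature.AnabelianGeometry.EtaleTheta.SettingModel

open Literature.AnabelianGeometry.SemiGraphs _root_.Function

variable (p : ℕ) [Fact p.Prime]

/-! ### The kit laws at the χ-model -/

/-- **`χ^Θ(g) = 1` for `g ∈ (Δ^tp_X)^Θ`** at `modelχ` (`χ^Θ = χ ∘ aug^Θ`, `aug = 1` on `Δ^tp_X`). [cite: MochizukiEtTh2009, §1 p.12] -/
theorem yCoordKitχ_chiT_eq_one {g : CurveTheta.GTheta (curveχ p)}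
    (hg : g ∈ (ThetaSetting.modelχ p).DeltaTemp.map (ThetaSetting.modelχ p).toTheta) : (yCoordKitχ p).chiT g = 1 := by
  obtain ⟨g₀, hg₀, rfl⟩ := hg
  have hright : g₀.right = 1 := (mem_deltaTempχ_iff p g₀).mp hg₀
  show chi p (CurveTheta.augTheta (curveχ p) (CurveTheta.toTheta (curveχ p) g₀)) = 1
  rw [CurveTheta.augTheta_toTheta]
  show chi p (augχ p g₀) = 1
  rw [augχ_apply, hright, map_one]

/-- **On `(Δ^tp_Y)^Θ`: `ŷ(x) = 1 ↔ x ∈ Δ_Θ`** at `modelχ` (abc-iut-L2-d1 proved it on `(Δ^tp_Ÿ)^Θ`; the argument — degree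
`0` kills the `x`-levels, `ŷ = 1` kills the `y`-levels — only uses membership in `Δ^tp_Y`).
[cite: MochizukiEtTh2009, Prop 1.5 (i) p.23] -/
theorem yThetaχ_eq_one_iff_mem_deltaTheta_of_mem_dtpY {x : CurveTheta.GTheta (curveχ p)}
    (hx : x ∈ (ThetaSetting.modelχ p).DtpYTheta) : yThetaχ p x = 1 ↔ x ∈ (ThetaSetting.modelχ p).DeltaTheta := by
  refine ⟨fun h => ?_, fun h => yThetaχ_eq_one_of_mem_deltaTheta p h⟩
  obtain ⟨g, hg, rfl⟩ := hx
  have hY : g ∈ (ThetaSetting.modelχ p).GtpY := (Subgroup.mem_inf.mp hg).1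
  have hright : g.right = 1 := (mem_deltaTempχ_iff p g).mp (Subgroup.mem_inf.mp hg).2
  have hx0 : g.left ∈ gfpSnd.ker := left_mem_ker_of_mem_GtpY hY
  rw [yThetaχ_toTheta] at h
  change CurveTheta.toTheta (curveχ p) g ∈ (CurveTheta.thetaToEll (curveχ p)).ker
  rw [CurveTheta.mk_mem_ker_thetaToEll_iff, mem_ellKerχ_iff]
  refine ⟨fun N => ⟨levelHom_x_eq_zero hx0, ?_⟩, hright⟩
  rw [hHat_y_eq_zero_iff]
  change modN N (yCoordχ p g) = 1
  rw [h, map_one]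

/-- Kit law 2 in kit form at `modelχ`. [cite: MochizukiEtTh2009, Prop 1.5 (i) p.23] -/
theorem yCoordKitχ_ker_law :
    ∀ g ∈ (ThetaSetting.modelχ p).DtpYTheta, (yCoordKitχ p).y g = 1 ↔ g ∈ (ThetaSetting.modelχ p).DeltaTheta :=
  fun _ hg => yThetaχ_eq_one_iff_mem_deltaTheta_of_mem_dtpY p hg

/-- **`inl(b^t) ∈ Δ^tp_Y` with `ŷ = t`** at `modelχ`. [cite: MochizukiEtTh2009, §1 p.12] -/
theorem exists_mem_dtpY_y_eq_modelχ (t : ZH) :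
    ∃ g ∈ (ThetaSetting.modelχ p).DtpYTheta, (yCoordKitχ p).y g = t :=
  ⟨CurveTheta.toTheta (curveχ p) (SemidirectProduct.inl (bPowGfp t)),
    Subgroup.mem_map_of_mem _ (inl_bPowGfp_mem_dtpY p t), yCoordKitχ_y_inl_bPowGfp p t⟩

/-- **`inl(b^{s²}) ∈ Δ^tp_Ÿ` with `ŷ = s²`** at `modelχ` (membership is abc-iut-L2-d1's `inl_bPowGfp_sq_mem_dtpYddN_one`).
[cite: MochizukiEtTh2009, Prop 1.5 (ii) p.23] -/
theorem exists_mem_dtpYdd_y_eq_sq_modelχ (s : ZH) :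
    ∃ g ∈ ((ThetaSetting.modelχ p).DtpYddN 1).map (ThetaSetting.modelχ p).toTheta, (yCoordKitχ p).y g = s ^ 2 :=
  ⟨CurveTheta.toTheta (curveχ p) (SemidirectProduct.inl (bPowGfp (s ^ 2))),
    Subgroup.mem_map_of_mem _ (inl_bPowGfp_sq_mem_dtpYddN_one p s), yCoordKitχ_y_inl_bPowGfp p (s ^ 2)⟩

/-! ### Prop. 1.5 (i) «F¹/F² = Ẑ·log(U)» at the χ-model -/

/-- **[EtTh] Prop. 1.5 (i) «F¹/F² = Ẑ·log(U)» at `modelχ`** for EVERY Kummer datum whose `log(U)` is the F6 class `logUχ`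
(= the kit class of `yCoordKitχ`, `rfl`), every `Compat` witness. [cite: MochizukiEtTh2009, Prop 1.5 (i) p.23] -/
theorem prop15iQuot_modelχ_of_logU_eq (hC : (ThetaSetting.modelχ p).Compat) {E : (ThetaSetting.modelχ p).KummerData}
    (hE : E.logU = logUχ p) : ThetaSetting.Prop15iQuot E hC :=
  (yCoordKitχ p).prop15iQuot_of_laws hC (hasThetaTopology_modelχ p) (ThetaSetting.modelχ_isEtThOrigin p)
    (fun _ hg => yCoordKitχ_chiT_eq_one p hg) (yCoordKitχ_ker_law p) (exists_mem_dtpY_y_eq_modelχ p)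
    (bijective_deltaThetaCoordχ p) hE

/-- **[EtTh] Prop. 1.5 (ii) «F̈¹/F̈² = Ẑ·log(Ü)» at `modelχ` by the kit route**, for EVERY Kummer datum whose `log(Ü)` is
`logUddχ` (abc-iut-L2-d1's `prop15iiQuot_kummerDataχSec` is the instance at `kummerDataχSec` / `compat_modelχ`).
[cite: MochizukiEtTh2009, Prop 1.5 (ii) p.23] -/
theorem prop15iiQuot_modelχ_of_logUdd_eq (hC : (ThetaSetting.modelχ p).Compat) {E : (ThetaSetting.modelχ p).KummerData}
    (hE : E.logUdd = logUddχ p) : ThetaSetting.Prop15iiQuot E hC :=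
  (yCoordKitχ p).prop15iiQuot_of_laws hC (hasThetaTopology_modelχ p) (ThetaSetting.modelχ_isEtThOrigin p)
    (fun _ hg => yCoordKitχ_chiT_eq_one p hg) ((yCoordKitχ p).ker_law_Ydd_of_Y (yCoordKitχ_ker_law p))
    (exists_mem_dtpYdd_y_eq_sq_modelχ p) (bijective_deltaThetaCoordχ p) hE

/-- **Prop. 1.5 (i)-Quot at the section Kummer datum `kummerDataχSec`** (the datum on which points are evaluated),
every `Compat` witness. [cite: MochizukiEtTh2009, Prop 1.5 (i) p.23] -/
theorem prop15iQuot_kummerDataχSec (hC : (ThetaSetting.modelχ p).Compat) :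
    ThetaSetting.Prop15iQuot (kummerDataχSec p) hC :=
  prop15iQuot_modelχ_of_logU_eq p hC rfl

/-- **Prop. 1.5 (i)-Quot at the F6 Kummer data `kummerDataχ`.** [cite: MochizukiEtTh2009, Prop 1.5 (i) p.23] -/
theorem prop15iQuot_kummerDataχ (hC : (ThetaSetting.modelχ p).Compat) :
    ThetaSetting.Prop15iQuot (kummerDataχ p) hC :=
  prop15iQuot_modelχ_of_logU_eq p hC rfl

/-- **Prop. 1.5 (ii)-Quot at `kummerDataχSec` for every `Compat` witness** (abc-iut-L2-d1's instance is at `compat_modelχ`).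
[cite: MochizukiEtTh2009, Prop 1.5 (ii) p.23] -/
theorem prop15iiQuot_kummerDataχSec' (hC : (ThetaSetting.modelχ p).Compat) :
    ThetaSetting.Prop15iiQuot (kummerDataχSec p) hC :=
  prop15iiQuot_modelχ_of_logUdd_eq p hC rfl

section OfSection

variable {p}
variable (s : GQp p →* PiTpχ p) (hs : Continuous s) (hsec : ∀ σ, (ThetaSetting.modelχ p).aug (s σ) = σ)
  (hsY : (ThetaSetting.modelχ p).GK.map s ≤ (ThetaSetting.modelχ p).GtpY)
  (hsYdd : (ThetaSetting.modelχ p).GKdd.map s ≤ (ThetaSetting.modelχ p).GtpYdd)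

/-- **Prop. 1.5 (i)-Quot for EVERY section Kummer datum of the F6 core `kummerCoreχ`.** [cite: MochizukiEtTh2009, Prop 1.5 (i) p.23] -/
theorem prop15iQuot_ofSection_modelχ (hC : (ThetaSetting.modelχ p).Compat) :
    ThetaSetting.Prop15iQuot ((kummerCoreχ p).toKummerDataOfSection s hs hsec hsY hsYdd) hC :=
  prop15iQuot_modelχ_of_logU_eq p hC rfl

/-- **Prop. 1.5 (ii)-Quot for EVERY section Kummer datum of the F6 core `kummerCoreχ`.** [cite: MochizukiEtTh2009, Prop 1.5 (ii) p.23] -/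
theorem prop15iiQuot_ofSection_modelχ (hC : (ThetaSetting.modelχ p).Compat) :
    ThetaSetting.Prop15iiQuot ((kummerCoreχ p).toKummerDataOfSection s hs hsec hsY hsYdd) hC :=
  prop15iiQuot_modelχ_of_logUdd_eq p hC rfl

end OfSection

/-! ### The stage-1 truth table of Prop. 1.5 at `kummerDataχSec` -/

/-- **THE TRUTH TABLE AT STAGE 1**: at the section Kummer datum `kummerDataχSec p` of the SPLIT χ-model, for every `Compat`
witness, Prop. 1.5 (i) ∧ (ii) ∧ (i)-Quot ∧ (ii)-Quot HOLD, while (iii) FAILS for the étale-theta datum of EVERY `η̈`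
(abc-iut-L2-t12's `not_prop15iii_etaleThetaDataχSec`: the split Galois factor fixes `log(Ü)` up to units, which the
`−a²·log q̈` term forbids). Contrast: all five hold at the Tate-sheared `modelχq p 1 2`
(`prop15_all_five_inrSection_modelχq`). [cite: MochizukiEtTh2009, Prop 1.5 p.23] -/
theorem prop15_truthTable_kummerDataχSec (hC : (ThetaSetting.modelχ p).Compat) :
    ThetaSetting.Prop15i (kummerDataχSec p) hC ∧ ThetaSetting.Prop15ii (kummerDataχSec p) hC ∧
      ThetaSetting.Prop15iQuot (kummerDataχSec p) hC ∧ ThetaSetting.Prop15iiQuot (kummerDataχSec p) hC ∧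
        ∀ η : (ThetaSetting.modelχ p).H1 (ThetaSetting.modelχ p).GtpYdd,
          ¬ ThetaSetting.Prop15iii (etaleThetaDataχSec p η) hC :=
  ⟨prop15i_kummerDataχSec p hC, prop15ii_kummerDataχSec p hC, prop15iQuot_kummerDataχSec p hC,
    prop15iiQuot_kummerDataχSec' p hC, fun η => not_prop15iii_etaleThetaDataχSec p hC η⟩

/-- **Census form (NV, Y-side)**: there are a theta setting of [EtTh] origin, a `Compat` witness and a Kummer datum for
which the root predicate `Prop15iQuot` («F¹/F² = Ẑ·log(U)») holds. [cite: MochizukiEtTh2009, Prop 1.5 (i) p.23] -/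
theorem _root_.Literature.AnabelianGeometry.EtaleTheta.ThetaSetting.exists_isEtThOrigin_prop15iQuot :
    ∃ (D : ThetaSetting p) (hC : D.Compat) (E : D.KummerData), D.IsEtThOrigin ∧ ThetaSetting.Prop15iQuot E hC :=
  ⟨ThetaSetting.modelχ p, compat_modelχ p, kummerDataχSec p, ThetaSetting.modelχ_isEtThOrigin p,
    prop15iQuot_kummerDataχSec p _⟩

/-- **Root-level form of the stage-1 table**: SOME theta setting of [EtTh] origin carries, at its `compat` witness, a Kummer
datum with (i) ∧ (ii) ∧ (i)-Quot ∧ (ii)-Quot whose every étale-theta datum VIOLATES the typed (iii) — the four clauses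
do not imply the fifth over the typed interface. [cite: MochizukiEtTh2009, Prop 1.5 p.23] -/
theorem _root_.Literature.AnabelianGeometry.EtaleTheta.ThetaSetting.exists_isEtThOrigin_prop15_four_not_iii :
    ∃ (D : ThetaSetting p) (E : D.KummerData), D.IsEtThOrigin ∧
      ThetaSetting.Prop15i E D.compat ∧ ThetaSetting.Prop15ii E D.compat ∧
        ThetaSetting.Prop15iQuot E D.compat ∧ ThetaSetting.Prop15iiQuot E D.compat ∧
          ∀ η : D.H1 D.GtpYdd, ¬ ThetaSetting.Prop15iii (E.etaleThetaDataOfClass η) D.compat :=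
  ⟨ThetaSetting.modelχ p, kummerDataχSec p, ThetaSetting.modelχ_isEtThOrigin p, prop15_truthTable_kummerDataχSec p _⟩

end Literature.AnabelianGeometry.EtaleTheta.SettingModel

end
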